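import Summits.HubbardSuperconductivity.HubbardSuperconductivity.Theorems.BalabanIRBirEveryGroundStateAffine
import Literature.MathematicalPhysics.QuantumLattice.HubbardWave0LiebProofs
import Literature.MathematicalPhysics.QuantumLattice.HubbardRingPerronFrobeniusProofs
import Mathlib.Combinatorics.SimpleGraph.Connectivity.Connected
import Mathlib.LinearAlgebra.FiniteDimensional.Lemmas

/-!
# Route `BalabanIR`, crux 5 `BirEveryGroundState` (item `stmt-HubbardSuperconductivity-2083`),
# line `spectral-curve-anchor`: Lieb's attractive anchor (`stub_liebAnchor`)

Helper (`--supports`) for the crux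
`Summit.HubbardSuperconductivity.HubbardSuperconductivity.Theses.BalabanIR.BirEveryGroundState`,
line `spectral-curve-anchor`, stub `stub_liebAnchor`.

**Statement (`stub_liebAnchor`).** For `U₀ < 0` the ground eigenspace of the Hubbard torus
pencil `T + U₀ D = hubbardTorus 2 L 1 U₀` (hopping `T = hubbardTorus 2 L 1 0` plus `U₀` times the
double-occupancy number `D = Σ_x n_{x↑} n_{x↓}`, `hamiltonian_eq_add_smul_doublon`) in the joint
sector `S = szSector (2m) 0` (`2m` particles, `S^z = 0`, `m ≤ |Λ|`) is ONE-dimensional: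
`finrank (S ⊓ eigenspace (T + U₀ D) (minEnergyOn (T + U₀ D) S)) = 1`. This is the anchor (a
simple point of the sector spectral curve) on the attractive side.

**Proof.** Lieb's Theorem 1 (PRL 62 (1989) 1201), proved in tree as `lieb_attractive_holds`: on a
connected graph with `t ≠ 0`, `U < 0` and `N = 2m ≤ 2|Λ|` even, the `N`-particle ground state of
`hamiltonian G t U` is unique up to scalars. The `N`-particle ground energy is attained in the
`S^z = 0` sector (`groundEnergyAt_eq_minEnergyOn_szSector`), so every nonzero vector of
`S ⊓ eigenspace (H, e₀)` is an `N`-particle ground state; the eigenspace is therefore the line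
spanned by the sector ground state supplied by `szSector_groundState`
(`finrank_szSector_groundEigenspace_eq_one`, any connected graph). The fermionic torus graph
`fermionTorusGraph d L` (`L ≠ 0`) is connected: it is the pull-back of the circulant torus graph
`torusGraph d L` along the bijection `FermionTorus.equivTorusSite`, and on `torusGraph d L` every
site `x = Σ_i x_i e_i` is reached from `0` by unit jumps (`torusGraph_reachable_zero`, proved here
directly by induction on the coordinates to keep the imports light; `fermionTorusGraph_connected`).

Everything used is proved in the tree; no definition and no named fact is introduced.
-/

noncomputable section

namespace Summit.HubbardSuperconductivity.HubbardSuperconductivity.Theorems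

open Matrix Finset
open Literature.MathematicalPhysics.QuantumLattice
open Literature.Probability.LatticeModels
open scoped ComplexOrder

/-! ### Lieb's Theorem 1 in eigenspace language (any connected graph) -/

section General

variable {Λ : Type*} [LinearOrder Λ] [Fintype Λ] (G : SimpleGraph Λ) [DecidableRel G.Adj]

/-- **Lieb's attractive ground state spans the sector ground eigenspace.** For `G` connected,
`t ≠ 0`, `U < 0` and `n ≤ |Λ|`, the ground eigenspace of `H = hamiltonian G t U` in the joint
sector `(2n, S^z = 0)` — `szSector (2n) 0 ⊓ eigenspace (H, minEnergyOn H (szSector (2n) 0))` — has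
dimension exactly `1`: it contains a sector ground state (`szSector_groundState`), its energy is
the `2n`-particle ground energy (`groundEnergyAt_eq_minEnergyOn_szSector`), so its nonzero
vectors are `2n`-particle ground states, which are unique up to scalars by Lieb's Theorem 1
(`lieb_attractive_holds`). Lieb, PRL 62 (1989) 1201, Theorem 1. [cite: LiebPRL1989, Theorem 1] -/
theorem finrank_szSector_groundEigenspace_eq_one (hG : G.Connected) {t U : ℝ} (ht : t ≠ 0)
    (hU : U < 0) {n : ℕ} (hn : n ≤ Fintype.card Λ) :
    Module.finrank ℂ ↥(szSector (Λ := Λ) (2 * n) 0 ⊓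
      Module.End.eigenspace (Matrix.toLin' (hamiltonian G t U))
        ((((hamiltonian G t U).minEnergyOn (szSector (2 * n) 0) : ℝ) : ℂ))) = 1 := by
  -- the sector energy is the `2n`-particle ground energy (`SU(2)` symmetry)
  have he : (hamiltonian G t U).minEnergyOn (szSector (2 * n) 0) =
      groundEnergy (hamiltonian G t U) (2 * n) :=
    (groundEnergyAt_eq_minEnergyOn_szSector G t U hn).symm
  -- Lieb's Theorem 1: uniqueness of the `2n`-particle ground state up to scalars
  obtain ⟨huniq, -⟩ :=
    lieb_attractive_holds G hG t U ht hU (2 * n) (even_two_mul n) (by omega)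
  -- a ground state in the sector exists
  obtain ⟨⟨ψ, hψS, hψ0, hHψ⟩, -⟩ := szSector_groundState G t U hn
  set E₀ : Submodule ℂ (Fock (Orb Λ)) := szSector (Λ := Λ) (2 * n) 0 ⊓
      Module.End.eigenspace (Matrix.toLin' (hamiltonian G t U))
        ((((hamiltonian G t U).minEnergyOn (szSector (2 * n) 0) : ℝ) : ℂ)) with hE₀
  have hψE : ψ ∈ E₀ :=
    Submodule.mem_inf.2
      ⟨hψS, Module.End.mem_eigenspace_iff.2 (by rw [Matrix.toLin'_apply]; exact hHψ)⟩
  -- every nonzero vector of `E₀` is a `2n`-particle ground state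
  have hgs : ∀ v ∈ E₀, v ≠ 0 → IsGroundState (hamiltonian G t U) (2 * n) v := by
    intro v hv hv0
    obtain ⟨hvS, hvE⟩ := Submodule.mem_inf.1 hv
    refine ⟨((mem_szSector_iff _ _ _).1 hvS).1, hv0, ?_⟩
    have h := Module.End.mem_eigenspace_iff.1 hvE
    rwa [Matrix.toLin'_apply, he] at h
  have hψgs : IsGroundState (hamiltonian G t U) (2 * n) ψ := hgs ψ hψE hψ0
  -- hence `E₀` is the line through `ψ`
  have hEq : E₀ = ℂ ∙ ψ := by
    refine le_antisymm (fun v hv => ?_) ((Submodule.span_singleton_le_iff_mem ψ E₀).2 hψE)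
    by_cases hv0 : v = 0
    · rw [hv0]
      exact Submodule.zero_mem _
    obtain ⟨a, rfl⟩ := huniq ψ v hψgs (hgs v hv hv0)
    exact Submodule.smul_mem _ a (Submodule.mem_span_singleton_self ψ)
  rw [hEq, finrank_span_singleton hψ0]

end General

/-! ### Connectivity of the torus graphs -/

/-- On the discrete torus `(ℤ/Lℤ)^d` every multiple `y + n eᵢ` of a unit jump is reachable from
`y` in `torusGraph d L` (each step `z ↦ z + eᵢ` is an edge, or the identity when `L = 1`).
Friedli–Velenik (2017) §3.1. [folklore] -/
theorem torusGraph_reachable_add_single {d L : ℕ} (y : TorusSite d L) (i : Fin d) :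
    ∀ n : ℕ, (torusGraph d L).Reachable y (y + Pi.single i (n : ZMod L))
  | 0 => by rw [Nat.cast_zero, Pi.single_zero, add_zero]
  | n + 1 => by
      refine (torusGraph_reachable_add_single y i n).trans ?_
      have hz : y + Pi.single i ((n + 1 : ℕ) : ZMod L) =
          (y + Pi.single i (n : ZMod L)) + Pi.single i 1 := by
        rw [Nat.cast_succ, Pi.single_add, add_assoc]
      rw [hz]
      by_cases h : y + Pi.single i (n : ZMod L) = (y + Pi.single i (n : ZMod L)) + Pi.single i 1
      · exact h ▸ SimpleGraph.Reachable.refl _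
      · exact SimpleGraph.Adj.reachable ((torusGraph_adj_iff _ _).2 ⟨h, Or.inl ⟨i, rfl⟩⟩)

/-- **Every site of the torus graph `(ℤ/Lℤ)^d` (`L ≠ 0`) is reachable from `0`**: write
`x = Σ_i x_i eᵢ` with `x_i ∈ {0, …, L-1}` (`ZMod.natCast_zmod_val`) and move coordinate by
coordinate along unit jumps (`torusGraph_reachable_add_single`). (Connectivity of `torusGraph d L`
itself is recorded in the `BoseEinsteinCondensation` theorems via lattice paths of `ℤ^d`; this
direct argument keeps the Hubbard route free of those imports.) Friedli–Velenik (2017) §3.1.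
[folklore] -/
theorem torusGraph_reachable_zero {d L : ℕ} [NeZero L] (x : TorusSite d L) :
    (torusGraph d L).Reachable 0 x := by
  have key : ∀ s : Finset (Fin d),
      (torusGraph d L).Reachable 0 (∑ i ∈ s, (Pi.single i (x i) : TorusSite d L)) := by
    intro s
    induction s using Finset.induction_on with
    | empty => rw [Finset.sum_empty]
    | insert a s ha ih =>
        rw [Finset.sum_insert ha, add_comm]
        refine ih.trans ?_
        have h := torusGraph_reachable_add_single (∑ i ∈ s, (Pi.single i (x i) : TorusSite d L))
          a (x a).val
        rwa [ZMod.natCast_zmod_val] at h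
  have hx : x = ∑ i, (Pi.single i (x i) : TorusSite d L) := (Finset.univ_sum_single x).symm
  rw [hx]
  exact key Finset.univ

/-- **The fermionic torus graph is connected** (`L ≠ 0`): `fermionTorusGraph d L` is the
pull-back of `torusGraph d L` along the bijection `FermionTorus.equivTorusSite`
(`SimpleGraph.Iso.comap`), graph isomorphisms preserve connectivity, and `torusGraph d L` is
connected (`torusGraph_reachable_zero`). Friedli–Velenik (2017) §3.1; Lieb, PRL 62 (1989) 1201
(connectivity hypothesis of Theorem 1). [folklore] -/
theorem fermionTorusGraph_connected (d L : ℕ) [NeZero L] : (fermionTorusGraph d L).Connected :=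
  (SimpleGraph.Iso.comap (FermionTorus.equivTorusSite (d := d) (L := L))
    (torusGraph d L)).connected_iff.2
      ((SimpleGraph.connected_iff_exists_forall_reachable _).2 ⟨0, torusGraph_reachable_zero⟩)

/-! ### The stub -/

/-- The Hubbard torus Hamiltonian as an affine pencil in the coupling:
`hubbardTorus d L t 0 + U · Σ_x n_{x↑} n_{x↓} = hubbardTorus d L t U`
(`hamiltonian_eq_add_smul_doublon` on the torus graph). Lieb, PRL 62 (1989) 1201. [folklore] -/
theorem hubbardTorus_zero_add_smul_doublon (d L : ℕ) (t U : ℝ) :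
    hubbardTorus d L t 0 + (U : ℂ) • ∑ x : FermionTorus d L, numberOp x 0 * numberOp x 1 =
      hubbardTorus d L t U :=
  (hamiltonian_eq_add_smul_doublon (fermionTorusGraph d L) t U).symm

/-- `hubbardTorus d L t U` is the Hubbard Hamiltonian of the torus graph `fermionTorusGraph d L`
(definitional unfolding, recorded as a rewrite rule). Lieb, PRL 62 (1989) 1201. [folklore] -/
theorem hubbardTorus_eq_hamiltonian (d L : ℕ) (t U : ℝ) :
    hubbardTorus d L t U = hamiltonian (fermionTorusGraph d L) t U :=
  rfl

/-- **Stub `stub_liebAnchor` (line `spectral-curve-anchor` of crux `BirEveryGroundState`):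
Lieb's attractive anchor.** For `L ≠ 0`, `m ≤ |Λ|` (`Λ = FermionTorus 2 L`) and `U₀ < 0`, the
ground eigenspace of the Hubbard torus pencil `T + U₀ D` (`T = hubbardTorus 2 L 1 0` the hopping
matrix, `D = Σ_x n_{x↑} n_{x↓}` the double-occupancy number; `T + U₀ D = hubbardTorus 2 L 1 U₀`) in
the joint sector `S = szSector (2m) 0` is one-dimensional:
`finrank (S ⊓ eigenspace (T + U₀ D) (minEnergyOn (T + U₀ D) S)) = 1`. Lieb's Theorem 1 on the
connected torus graph with `t = 1 ≠ 0`, `N = 2m` even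
(`finrank_szSector_groundEigenspace_eq_one`, `fermionTorusGraph_connected`).
Lieb, PRL 62 (1989) 1201, Theorem 1. [cite: LiebPRL1989, Theorem 1] -/
theorem stub_liebAnchor : ∀ (L : ℕ) [NeZero L] (m : ℕ), m ≤ Fintype.card (FermionTorus 2 L) →
    ∀ U₀ : ℝ, U₀ < 0 →
    let T := hubbardTorus 2 L 1 0
    let D : Matrix (Finset (Orb (FermionTorus 2 L))) (Finset (Orb (FermionTorus 2 L))) ℂ :=
      ∑ x : FermionTorus 2 L, numberOp x 0 * numberOp x 1
    let S := szSector (Λ := FermionTorus 2 L) (2 * m) 0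
    Module.finrank ℂ ↥(S ⊓ Module.End.eigenspace (Matrix.toLin' (T + (U₀ : ℂ) • D))
      ((((T + (U₀ : ℂ) • D).minEnergyOn S : ℝ) : ℂ))) = 1 := by
  intro L _ m hm U₀ hU₀
  dsimp only
  rw [hubbardTorus_zero_add_smul_doublon 2 L 1 U₀, hubbardTorus_eq_hamiltonian 2 L 1 U₀]
  exact finrank_szSector_groundEigenspace_eq_one (fermionTorusGraph 2 L)
    (fermionTorusGraph_connected 2 L) one_ne_zero hU₀ hm

end Summit.HubbardSuperconductivity.HubbardSuperconductivity.Theorems
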